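/-
Copyright (c) 2026 the pub-hodgecm-mathlib formalisation cell (harness21).  Prover seat hodgecm-mathlib-K2E3-p32 (g4) (E3 hand on strike line L1; F-chain INTEGRATOR of the
U1-glob TOP, road (R-eq) of RULINGS «M-160j∕k», LEAD F0P6-plan (g16) HOURLY #14 ∕ BATCH #292), Track B «K2-LIT» ∕ hLiu418 = `stmt-HodgeConjecture-24832`: THE (R-eq) CHAIN
COMPOSED END TO END — `slot_vanRes2E` FROM SOCKET #41, THE SIGN-FRAME CLASS LAW AND «THE GAUSSIAN GENERATORS ARE DEAD».  THEOREMS ONLY (no `def`, no `instance`, no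
notation, no named-fact hypothesis, no `sorry`); lane `--supports stmt-HodgeConjecture-24832 --as helper` (count-neutral).
-/
import Summits.HodgeConjecture.HodgeConjecture.Theorems.K2LiuResidueVanishesOfDeadSubmoduleSlot   -- ★ p865324 (K2E3-p14 (g10)): `resGen_eq_zero_slot` (design (ii) DIRECT; by value `h41 hK₀ hbase`)
import Summits.HodgeConjecture.HodgeConjecture.Theorems.K2LiuResidueDeadHolCutBase                -- ★ p865314 (K2E3-p32 (g4)): `dead_holCut_of_gaussian` (`hbase` ⇐ ONE letter `hG`)
import Summits.HodgeConjecture.HodgeConjecture.Theorems.K2LiuIwasawaDatumOfRecordSignFrames        -- ★ (K2E3-p31 (g2)): `hK₀_of_signFrameAdapted` (`hK₀` ⇐ the class law `hsf`)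
import HarnessLib

/-!
# Crux `HLiu418`, U1-glob TOP (#42F′ `slot_vanRes2E`), road (R-eq): THE CHAIN COMPOSED — `resGen hex = 0` FROM {socket #41, the sign-frame class law `hsf`, `hG`}

Cell `hodgecm-mathlib`, crux item hLiu418 = `stmt-HodgeConjecture-24832`; squad K2, strike line L1, LEAD F0P6-plan (g16) (HOURLY #14, RULINGS «M-160c∕j∕k»); U1 desk K2E3-p28 (g4);
`_slot` closer ★ p865324 (K2E3-p14 (g10)); (base) reducer ★ p865314 and generation letter ★ p865142 ∕ ★ p865190 (K2E3-p32 (g4)); DEAD-letters ★ p865141 (LH7-p08 (g3));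
class letter ★ `K2LiuIwasawaDatumOfRecordSignFrames` (K2E3-p31 (g2)); tie-probe typist K2E3-typ3 (g3) (v14 «SF»: `slot_vanRes2E` carries `hsf`).

THE POINT (integrator's junction, BY NAME).  After the (R-eq) landslide the #42F′ slot `slot_vanRes2E` («VAN-res(2,E)»: `resGen hex = 0` for the socket-#41 datum `hex` of the
twisted Siegel–Weil family `g_x` of every `x ∈ D_V`, `V` finite-dimensional and `K_∞`-stable) is the composite of THREE ★ heads:
  ★ `resGen_eq_zero_slot h41 … hK₀ hbase`       (the dead data form a `(𝔤_∞, K_∞)`-submodule containing the hol-cut stratum ⇒ everything is dead ⇒ `resGen = 0`),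
  ★ `hK₀ := hK₀_of_signFrameAdapted … hsf`       (F4's closure letter at a SIGN-FRAME-ADAPTED standard datum — the class the v14 tie carries as `hsf`),
  ★ `hbase := dead_holCut_of_gaussian h41 … hG`   (the hol-cut stratum is dead as soon as the Gaussian pure-tensor generators `E(v_G ⊗ f)` are),
so that BY VALUE exactly three letters remain: socket #41 (`h41`, paid at the tie by `sig_41`), the class law `hsf` (in the tie's context), and
  **`hG : ∀ f P E, IsPoleClearedCont … α 𝒦 (E(v_G ⊗ f)) P E → resNorm P E = 0`**   («the Gaussian generators are dead» — the scalar-`K_∞`-type stratum: ★ F1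
  `resGen_eq_zero_of_presentation` at ONE summand `x := E(v_G ⊗ f)` over the F2b datum ★ p865003, (4) `harch` from the (σ-A) road ∕ ★ p864523 §4, read on `resNorm` through ★
  `dead_of_resGen_eq_zero`).
THIS FILE is that composite as ONE name, so the v15 tie keys `slot_vanRes2E := resGen_eq_zero_slot_of_gaussian sig_41 L e … 𝒦 h𝒦 hsf ?hG V hVfd hVst x hex` and the by-value
census of #42F′'s VAN-res line reads off ONE binder list.
* **`resGen_eq_zero_slot_of_gaussian (h41) (L … 𝒦 h𝒦) (hsf) (hG) (V hVfd hVst x hex) : resGen hex = 0`.**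
References: [KudlaRallis1994] S. Kudla, S. Rallis, Ann. of Math. 140 (1994) §1 Thm. 1.1 (the regularised Siegel–Weil formula ∕ first-term identity: the residue is
`(𝔤,K)`-equivariant); [MoeglinWaldspurger1995] IV.1.9–IV.1.11 (residues of Eisenstein series are automorphic, equivariantly); [Howe1989] R. Howe, J. AMS 2 (1989) §3 (the Fock
model is cyclic on the Gaussian); [Liu2021] Y. Liu, Camb. J. Math. 9 (2021) App. B Lem. B.12 + proof of Prop. B.8 pp. 103–106; [KonnoKonno2007] §3.1 (sign frames).
HONEST LABEL.  Count-neutral helper: `HC_CM` is proved only modulo the 7 printed citations (2 remaining named inputs: hLiu418 = `stmt-HodgeConjecture-24832`,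
h413 = `stmt-HodgeConjecture-24833`) until rung 0 closes; `slot_vanRes2E` stays OPEN — BY VALUE modulo {`sig_41`, `hsf`, `hG`} exactly.
-/

set_option autoImplicit false
set_option linter.dupNamespace false -- the mandated namespace repeats `HodgeConjecture.HodgeConjecture`

noncomputable section

open scoped Matrix Topology TensorProduct SchwartzMap Classical
open NumberField NumberField.mixedEmbedding IsDedekindDomain MeasureTheory Filter
open Literature.NumberTheory.Automorphic Literature.NumberTheory.Automorphic.UnitaryGroup Literature.NumberTheory.GaloisRepresentations
open Literature.NumberTheory.GelbartRogawski1991 Literature.NumberTheory.GelbartRogawski1991.GRConstruction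
open Literature.NumberTheory.GelbartRogawski1991.GRConstruction.DoubledWeilDetTwist
open Literature.NumberTheory.GelbartRogawski1991.UnitaryDualPair
open Literature.NumberTheory.GelbartRogawski1991.UnitaryDualPair.LocalSplitting
open Literature.NumberTheory.K2Lit.SiegelDoubled
open Literature.NumberTheory.Automorphic.IdeleClassGroup
open Literature.NumberTheory.Automorphic.Liu2021
open Literature.NumberTheory.Automorphic.Liu2021.Def411WeilCarriers
open Literature.NumberTheory.Automorphic.Liu2021.Def411WeilCarriersDoubling
open Literature.NumberTheory.Weil1964
open Literature.RepresentationTheory.Liu2021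
open Literature.RepresentationTheory.HarrisKudlaSweet1996 (IsSplittingChar)
open Literature.RepresentationTheory.KonnoKonno2007.RealDualPair
open Literature.RepresentationTheory.KonnoKonno2007.RealDualPair.UForm
open Summit.HodgeConjecture.HodgeConjecture.Cruxes.HLiu418.K2LiuFirstTermResidueFormDefs (resNorm)
open Summit.HodgeConjecture.HodgeConjecture.Cruxes.HLiu418.K2LiuFirstTermResidueGenDefs
open Summit.HodgeConjecture.HodgeConjecture.Cruxes.HLiu418.K2LiuFaceGLetterDefs
open Summit.HodgeConjecture.HodgeConjecture.Cruxes.HLiu418.K2LiuArchSectionPlaceBlock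
open Summit.HodgeConjecture.HodgeConjecture.Cruxes.HLiu418.K2LiuArchGaussianOfRecord (archGaussianOfRecord holCutOfRecord)
open Summit.HodgeConjecture.HodgeConjecture.Cruxes.HLiu418.K2LiuResidueVanishesOfDeadSubmoduleSlot (resGen_eq_zero_slot)
open Summit.HodgeConjecture.HodgeConjecture.Cruxes.HLiu418.K2LiuResidueDeadHolCutBase (dead_holCut_of_gaussian)
open Summit.HodgeConjecture.HodgeConjecture.Cruxes.HLiu418.K2LiuIwasawaDatumOfRecordSignFrames (hK₀_of_signFrameAdapted)

namespace Summit.HodgeConjecture.HodgeConjecture.Cruxes.HLiu418.K2LiuResidueVanishesSlotOfGaussian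

/-- **#42F′ `slot_vanRes2E` FROM SOCKET #41, THE SIGN-FRAME CLASS LAW AND THE DEAD GAUSSIAN GENERATORS — the (R-eq) chain composed.**  Frame of #42F′
(`e : Fin 2 × Fin 1 ≃ Fin n`, big frame `dV′ : Fin 3 → L`, `χ_b` unitary splitting, `α` with `χ_b³·α̃ = λ̃⁻¹`, `𝒦` standard).  BY VALUE: `h41` = socket #41 (★ STEP 0b's
bytes); `hsf` = the sign-frame class law of `𝒦` (`(a, 1_f) ∈ 𝒦.K ↔ a ∈ ⟨placeSec_𝔻 σ (kV k₁)⟩`, ★ `exists_isStd_signFrameAdapted`'s shape — the v14 tie's `hsf`);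
`hG` = every Gaussian pure-tensor generator `E(v_G ⊗ f)` is DEAD.  THEN for every finite-dimensional `K_∞`-stable `V` (the slot's `hVfd`, `hVst` bytes) and every
`x ∈ D_V`: `resGen hex = 0` for the slot's socket-#41 datum `hex` of `g_x`.  Proof: ★ `resGen_eq_zero_slot` with `hK₀ := hK₀_of_signFrameAdapted … hsf` and
`hbase := dead_holCut_of_gaussian h41 … hG`. [cite: KudlaRallis1994, §1 Thm. 1.1] [cite: MoeglinWaldspurger1995, IV.1.9–IV.1.11] [cite: Howe1989, §3]
[cite: Liu2021, App. B Lem. B.12 pp. 103–104] [cite: KonnoKonno2007, §3.1] -/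
theorem resGen_eq_zero_slot_of_gaussian
    (h41 : ∀ (L : Type) [Field L] [NumberField L] [IsCMField L] {n : ℕ} (e : Fin 2 × Fin 1 ≃ Fin n)
      (dV : Fin 2 → L) (hdV : ∀ i, IsCMField.complexConj L (dV i) = dV i) (hdV0 : ∀ i, dV i ≠ 0)
      (dW : Fin 1 → L) (hdW : ∀ i, IsCMField.complexConj L (dW i) = dW i) (hdW0 : ∀ i, dW i ≠ 0)
      (lam : Literature.NumberTheory.Automorphic.IdeleClassGroup L →ₜ* Circle) (hlam : IsConjugateSymplectic L lam),
      HasWeight L lam 1 →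
      ∀ (𝒦 : IwasawaDatum L e dV hdV dW hdW) (_h𝒦 : 𝒦.IsStd) (f : ℂ → HA L e dV hdV dW hdW → ℂ),
        IsStandardSectionFamily 𝒦 (toHeckeCharacter L lam⁻¹) f → (∀ s, Continuous (f s)) →
      ∃ (P : Finset ℂ) (Es : ℂ → HA L e dV hdV dW hdW → ℂ),
        (∀ h : HA L e dV hdV dW hdW, DifferentiableOn ℂ (fun s => Es s h) {s : ℂ | 0 < s.re}) ∧
        (∀ s : ℂ, 0 < s.re → Continuous (Es s)) ∧
        (∀ s : ℂ, 0 < s.re → ∀ (γ : ratH L e dV hdV dW hdW) (h : HA L e dV hdV dW hdW),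
          Es s ((γ : HA L e dV hdV dW hdW) * h) = Es s h) ∧
        (∀ (s : ℂ) (h : HA L e dV hdV dW hdW), (n : ℝ) / 2 < s.re →
          Es s h = (∏ p ∈ P, (s - p)) * eisensteinFamilyDelta L e dV hdV dW hdW f s h) ∧
        (∀ z : ℂ, 0 < z.re → ∃ C A r : ℝ, 0 < r ∧ ∀ s : ℂ, dist s z < r → ∀ h : HA L e dV hdV dW hdW,
          ‖Es s h‖ ≤ C * adelicHeightGL (n + n) L (h : GL (Fin (n + n)) (AdeleRing (𝓞 L) L)) ^ A))
    (L : Type) [Field L] [NumberField L] [IsCMField L] {n : ℕ} (e : Fin 2 × Fin 1 ≃ Fin n)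
    (dV : Fin 2 → L) (hdV : ∀ i, IsCMField.complexConj L (dV i) = dV i) (hdV0 : ∀ i, dV i ≠ 0)
    (dW : Fin 1 → L) (hdW : ∀ i, IsCMField.complexConj L (dW i) = dW i) (hdW0 : ∀ i, dW i ≠ 0)
    (lam : Literature.NumberTheory.Automorphic.IdeleClassGroup L →ₜ* Circle) (hlam : IsConjugateSymplectic L lam) (hwt : HasWeight L lam 1)
    {M' n' : ℕ} (eW : Fin 1 × Fin 3 ≃ Fin M') (e' : Fin 2 × Fin M' ≃ Fin n')
    (dV' : Fin 3 → L) (hdV' : ∀ k, IsCMField.complexConj L (dV' k) = dV' k) (hdV'0 : ∀ k, dV' k ≠ 0)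
    (χb : HeckeCharacter L) (hχbu : χb.IsUnitary) (hχbs : Literature.RepresentationTheory.HarrisKudlaSweet1996.IsSplittingChar L 1 χb)
    (α : UnitaryGroup.adelicOne (Fp L) L (IsCMField.complexConj L) →* ℂˣ) (hα : Continuous α)
    (hαrat : ∀ u : UnitaryGroup.adelicOne (Fp L) L (IsCMField.complexConj L),
      (u : Literature.NumberTheory.GaloisRepresentations.ideleGroup L) ∈ Literature.NumberTheory.GaloisRepresentations.principalIdeles L → α u = 1)
    (hχD : χb ^ 3 * DoubledWeilDetTwist.ratioHecke L α hα hαrat = toHeckeCharacter L lam⁻¹)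
    (𝒦 : IwasawaDatum L e dV hdV dW hdW) (h𝒦 : 𝒦.IsStd)
    -- ══ the SIGN-FRAME CLASS LAW of `𝒦` (the v14 tie's `hsf`; ★ `exists_isStd_signFrameAdapted`'s shape) — pays F4's closure letter `hK₀` BY NAME ══
    (hsf : ∀ a : UnitaryGroup.arch (Fp L) L (IsCMField.complexConj L) (n + n) (hermD L e dV hdV dW hdW),
        (UnitaryGroup.archToAdelic (Fp L) L (IsCMField.complexConj L) (n + n) (hermD L e dV hdV dW hdW) a : HA L e dV hdV dW hdW) ∈ 𝒦.K ↔
          a ∈ Submonoid.closure {k : UnitaryGroup.arch (Fp L) L (IsCMField.complexConj L) (n + n) (hermD L e dV hdV dW hdW) |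
          ∃ (σ : {v : InfinitePlace (Fp L) // v.IsReal}) (k₁ : Matrix.unitaryGroup (PosIdx (signVec (cmPlaceOver L) (fun k => Sum.elim (cmGramEntry L e dV hdV dW hdW) (-cmGramEntry L e dV hdV dW hdW) ((LocalSplitting.e₂ n).symm k)) (imagUnit L) σ)) ℂ × Matrix.unitaryGroup (NegIdx (signVec (cmPlaceOver L) (fun k => Sum.elim (cmGramEntry L e dV hdV dW hdW) (-cmGramEntry L e dV hdV dW hdW) ((LocalSplitting.e₂ n).symm k)) (imagUnit L) σ)) ℂ),
            k = placeSec L (IsCMField.complexConj L) (n + n) (IsCMField.complexConj_ne_one L) (cmPlaceOver L) (cmPlaceOver_smul L) (fun k => Sum.elim (cmGramEntry L e dV hdV dW hdW) (-cmGramEntry L e dV hdV dW hdW) ((LocalSplitting.e₂ n).symm k))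
            (gramD_gram_realDiagonal_entry_ne_zero L e dV hdV dW hdW hdV0 hdW0) (complexConj_imagUnit L) (imagUnit_ne_zero L) σ
            (cmPlaceOver_comap L) (gramD_eq_diagonal_cm L e dV hdV dW hdW) (J := hermD L e dV hdV dW hdW) rfl
            (complexConj_smul_infinitePlace L) (UForm.kV _ _ k₁)})
    -- ══ «THE GAUSSIAN GENERATORS ARE DEAD» (the scalar-`K_∞`-type stratum: ★ F1 at one summand + F2b ★ p865003 + (σ-A) ∕ ★ p864523 §4, via ★ `dead_of_resGen_eq_zero`) ══
    (hG : ∀ (f : FinSB (Fp L) (Fin (n' + n'))) (P : Finset ℂ) (E : ℂ → HA L e dV hdV dW hdW → ℂ),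
      IsPoleClearedCont L e dV hdV hdV0 dW hdW hdW0 eW e' dV' hdV' hdV'0 χb hχbu hχbs α 𝒦
        (piSchwartzBruhatEquiv (Fp L) (Fin (n' + n')) (archGaussianOfRecord L dV hdV hdV0 dW hdW hdW0 eW e' dV' hdV' hdV'0 ⊗ₜ[ℂ] f)) P E →
      resNorm P E = 0)
    -- ══ the slot's class `V` (finite-dimensional, `K_∞`-stable: `IsArchStable` unfolded), its datum `x ∈ D_V` and socket #41's datum `hex` of `g_x` ══
    (V : Submodule ℂ 𝓢(((Fin (n' + n')) → mixedSpace (Fp L)), ℂ)) (hVfd : FiniteDimensional ℂ V)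
    (hVst : ∀ ainf : UnitaryGroup.arch (Fp L) L (IsCMField.complexConj L) (n + n) (hermD L e dV hdV dW hdW),
      (UnitaryGroup.archToAdelic (Fp L) L (IsCMField.complexConj L) (n + n) (hermD L e dV hdV dW hdW) ainf : HA L e dV hdV dW hdW) ∈ 𝒦.K →
      ∀ a ∈ V, ∃ a'' ∈ V, ∀ f : FinSB (Fp L) (Fin (n' + n')),
        adelicMpCont.omega (Fp L) (Fin (n' + n')) (gramDA L e' dV hdV (tensorFrame L dW eW dV') (tensorFrame_real L dW hdW eW dV' hdV'))
            ((doubledWeilRep L e' dV hdV hdV0 (tensorFrame L dW eW dV') (tensorFrame_real L dW hdW eW dV' hdV')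
                  (tensorFrame_ne_zero L dW eW dV' hdW0 hdV'0) χb hχbu hχbs)
              (tensorEmb L e dV hdV dW hdW eW e' dV' hdV'
                (UnitaryGroup.archToAdelic (Fp L) L (IsCMField.complexConj L) (n + n) (hermD L e dV hdV dW hdW) ainf)))
            (piSchwartzBruhatEquiv (Fp L) (Fin (n' + n')) (a ⊗ₜ[ℂ] f)) =
          piSchwartzBruhatEquiv (Fp L) (Fin (n' + n')) (a'' ⊗ₜ[ℂ] f))
    (x : ↥(Submodule.span ℂ {x : piSchwartzBruhat (Fp L) (Fin (n' + n')) |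
        ∃ a ∈ V, ∃ f : FinSB (Fp L) (Fin (n' + n')), x = piSchwartzBruhatEquiv (Fp L) (Fin (n' + n')) (a ⊗ₜ[ℂ] f)}))
    (hex : ∃ (P : Finset ℂ) (Es : ℂ → HA L e dV hdV dW hdW → ℂ),
      (∀ h : HA L e dV hdV dW hdW, DifferentiableOn ℂ (fun s => Es s h) {s : ℂ | 0 < s.re}) ∧
      (∀ s : ℂ, 0 < s.re → Continuous (Es s)) ∧
      (∀ s : ℂ, 0 < s.re → ∀ (γ : ratH L e dV hdV dW hdW) (h : HA L e dV hdV dW hdW),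
        Es s ((γ : HA L e dV hdV dW hdW) * h) = Es s h) ∧
      (∀ (s : ℂ) (h : HA L e dV hdV dW hdW), (n : ℝ) / 2 < s.re →
        Es s h = (∏ p ∈ P, (s - p)) * eisensteinFamilyDelta L e dV hdV dW hdW
          (fun s₁ h₁ => ((DoubledWeilDetTwist.detChar L e dV hdV hdV0 dW hdW hdW0 α h₁ : ℂˣ) : ℂ) *
            stdExtension 𝒦 ((((3 : ℕ) : ℂ) - (n : ℂ)) / 2)
              (swSectionTensor L e dV hdV dW hdW eW e' dV' hdV' hdV0 hdW0 hdV'0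
                (doubledWeilRep L e' dV hdV hdV0 (tensorFrame L dW eW dV') (tensorFrame_real L dW hdW eW dV' hdV')
                  (tensorFrame_ne_zero L dW eW dV' hdW0 hdV'0) χb hχbu hχbs)
                (x : piSchwartzBruhat (Fp L) (Fin (n' + n')))) s₁ h₁) s h) ∧
      (∀ z : ℂ, 0 < z.re → ∃ C A r : ℝ, 0 < r ∧ ∀ s : ℂ, dist s z < r → ∀ h : HA L e dV hdV dW hdW,
        ‖Es s h‖ ≤ C * adelicHeightGL (n + n) L (h : GL (Fin (n + n)) (AdeleRing (𝓞 L) L)) ^ A)) :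
    resGen hex = 0 :=
  resGen_eq_zero_slot h41 L e dV hdV hdV0 dW hdW hdW0 lam hlam hwt eW e' dV' hdV' hdV'0 χb hχbu hχbs α hα hαrat hχD 𝒦 h𝒦
    (hK₀_of_signFrameAdapted L e dV hdV hdV0 dW hdW hdW0 hsf)
    (dead_holCut_of_gaussian h41 L e dV hdV hdV0 dW hdW hdW0 lam hlam hwt eW e' dV' hdV' hdV'0 χb hχbu hχbs α hα hαrat hχD 𝒦 h𝒦 hG)
    V hVfd hVst x hex

end Summit.HodgeConjecture.HodgeConjecture.Cruxes.HLiu418.K2LiuResidueVanishesSlotOfGaussian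

end
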